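import Summits.Ventures.HSemireg.FibreTestW3CommutingPairOneClassLemma
import Summits.Ventures.HSemireg.FibreTestW3CommutingPairTransferStep

/-!
# Venture HSemireg — fibre test (W³): ONE COMMUTING PAIR SUFFICES, FOR KILLING TRIPLES, AT EVERY AMPLITUDE

HONEST FRAMING. Kernel leaf for the computation cell `pub-hsemireg`, (W³) lane (theory seat th-3 gen 45;
record `theory/TH3-ANTICOMMUTING-DIRECTION.md` §11, THEOREM E). Assembly of the two structured leaves
`FibreTestW3CommutingPairTransferStep` (STEP (i)) and `FibreTestW3CommutingPairOneClassLemma` (STEP (ii)):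
in the letters of §11 (`x = u₁`, `y = u₂` the commuting pair; per class `p k = V₁`, `q k = V₂`, `r k = V₃`;
components `B₁ = -Y (r k)`, `B₂ = X (r k)`, `B₃ = Y (p k)` by (E1)), if `x y = y x` and every class is
Killing (`X (p k) = 0`, `Y (q k) = 0`, `Y (p k) + X (q k) = 0`) then `str T = 0`, for ANY ring and ANY
additive functional odd on `x, y, r k`. No cocycle relation (E2), nothing about `u₃`, squares or other
pairs. Nothing here constructs an object on an abelian variety, proves (W³)₄, or bears on HC, HC_CM, HC_AV.
-/

namespace Summit.Ventures.HSemireg.W3OneCommutingPairAllAmplitudes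

open Summit.Ventures.HSemireg

/-- THEOREM E of th-3 g45 (all amplitudes, Killing triples), in the letters of §11: one commuting pair of
pencil directions forces `str T = 0`. Three-line assembly of STEP (i) and the one-class lemma. -/
theorem supertrace_cubic_eq_zero_of_one_commuting_pair {R S : Type*} [Ring R] [AddCommGroup S]
    (str : R →+ S) (x y : R) (p q r : Fin 3 → R)
    (hxodd : ∀ w : R, str (x * w) = -str (w * x)) (hyodd : ∀ w : R, str (y * w) = -str (w * y))
    (hrodd : ∀ (k : Fin 3) (w : R), str (r k * w) = -str (w * r k))
    (hxy : x * y - y * x = 0) (hXp : ∀ k : Fin 3, x * p k + p k * x = 0)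
    (hYq : ∀ k : Fin 3, y * q k + q k * y = 0)
    (hK : ∀ k : Fin 3, y * p k + p k * y + x * q k + q k * x = 0) :
    str ((-(y * r 0 + r 0 * y)) * (x * r 1 + r 1 * x) * (y * p 2 + p 2 * y) - (-(y * r 0 + r 0 * y)) *
      (y * p 1 + p 1 * y) * (x * r 2 + r 2 * x) - (x * r 0 + r 0 * x) * (-(y * r 1 + r 1 * y)) * (y
      * p 2 + p 2 * y) + (x * r 0 + r 0 * x) * (y * p 1 + p 1 * y) * (-(y * r 2 + r 2 * y)) + (y * p
      0 + p 0 * y) * (-(y * r 1 + r 1 * y)) * (x * r 2 + r 2 * x) - (y * p 0 + p 0 * y) * (x * r 1 +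
      r 1 * x) * (-(y * r 2 + r 2 * y))) = 0 := by
  rw [W3CommutingPairTransferStep.supertrace_cubic_eq_sum_transfer_words str x y p r hxodd hyodd hrodd,
    W3CommutingPairOneClassLemma.supertrace_transfer_word_eq_zero str x y (p 0) (q 0) (r 1) (r 2) hxodd
      hyodd (hrodd 1) (hrodd 2) hxy (hXp 0) (hYq 0) (hK 0),
    W3CommutingPairOneClassLemma.supertrace_transfer_word_eq_zero str x y (p 1) (q 1) (r 2) (r 0) hxodd
      hyodd (hrodd 2) (hrodd 0) hxy (hXp 1) (hYq 1) (hK 1),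
    W3CommutingPairOneClassLemma.supertrace_transfer_word_eq_zero str x y (p 2) (q 2) (r 0) (r 1) hxodd
      hyodd (hrodd 0) (hrodd 1) hxy (hXp 2) (hYq 2) (hK 2), add_zero, add_zero]

end Summit.Ventures.HSemireg.W3OneCommutingPairAllAmplitudes
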